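import Literature.RingTheory.Etale.IndEtalePresentation
import Mathlib.Algebra.MvPolynomial.Variables
import Mathlib.LinearAlgebra.Finsupp.Span
import Mathlib.RingTheory.Unramified.Finite
import Mathlib.RingTheory.Flat.FaithfullyFlat.Algebra
import Mathlib.RingTheory.LocalRing.ResidueField.Ideal
import Mathlib.FieldTheory.IsAlgClosed.AlgebraicClosure
import HarnessLib

/-!
# Coproducts of étale algebras presented by polynomial blocks

For a family of étale `X`-algebras given by presentations `X[x₁,…,x_{n s}]/I s` (`s : ι`), the
coproduct `∐_s X[x]/I s = ⨂_s X[x]/I s` is the quotient of the polynomial ring in the disjoint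
union of the variables by the ideal generated by all blocks of relations. This file proves:

* `Coprod n I`, `Coprod.of`, `Coprod.lift`, `Coprod.hom_ext` — the coproduct and its universal
  property;
* `Coprod.etale` — **a finite coproduct (tensor product) of étale algebras is étale** (Stacks
  Project, Tag 00U0: finitely presented, and formally étale by unique infinitesimal lifting
  factor by factor);
* `Coprod.factorsEtale` — **an arbitrary coproduct of étale algebras is ind-étale** (it is the
  directed union of the finite sub-coproducts; factorization criterion of
  `IndEtaleFactorization.lean`);
* `Coprod.exists_prime_over`, `Coprod.faithfullyFlat` — if all blocks are faithfully flat, so is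
  the coproduct (a prime over `𝔭 ⊆ X` is the kernel of `∐_s B_s → κ(𝔭)^alg` assembled from
  geometric points of the fibres).

This is the algebra `B_E = B₁ ⊗ … ⊗ Bₙ` / `T(A) = colim_E B_E` of Stacks Project, Tag 097R
(construction of ind-étale algebras absorbing all faithfully flat étale covers), see
`EtaleClosedCover.lean`.

## References

* The Stacks Project, Tags 00U0, 097R. [StacksProject]

## Design notes

The coproduct is a plain quotient of `MvPolynomial (Σ s, Fin (n s)) X`; no tensor products of
families are used. Mathlib searched: `PiTensorProduct` has ring/algebra instances but no
étaleness or binary-decomposition algebra isomorphisms; `Algebra.FormallyEtale.iff_comp_bijective`,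
`MvPolynomial.exists_rename_eq_of_vars_subset_range`, `Submodule.exists_finset_of_mem_iSup`,
`Module.FaithfullyFlat.of_comap_surjective`. Nothing restated.
-/

universe u

namespace Literature.RingTheory.Etale

open MvPolynomial

variable {X : Type u} [CommRing X] {ι : Type u} (n : ι → ℕ)
  (I : ∀ s : ι, Ideal (MvPolynomial (Fin (n s)) X))

/-! ### The coproduct of presented algebras -/

/-- The block `X[x₁,…,x_{n s}] / I s`. [folklore] -/
abbrev Block (s : ι) : Type u := MvPolynomial (Fin (n s)) X ⧸ I s

/-- The embedding of the polynomial ring of block `s` into the big polynomial ring. [folklore] -/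
noncomputable def blockRename (s : ι) :
    MvPolynomial (Fin (n s)) X →ₐ[X] MvPolynomial (Σ s, Fin (n s)) X :=
  MvPolynomial.rename fun i : Fin (n s) => (⟨s, i⟩ : Σ s, Fin (n s))

/-- The ideal generated by all blocks of relations. [folklore] -/
noncomputable def coprodIdeal : Ideal (MvPolynomial (Σ s, Fin (n s)) X) :=
  ⨆ s, (I s).map (blockRename n s)

/-- **The coproduct `∐_s X[x]/I s`** as a quotient of the polynomial ring in the disjoint union of
the variables. [cite: StacksProject, Tag 097R] -/
abbrev Coprod : Type u := MvPolynomial (Σ s, Fin (n s)) X ⧸ coprodIdeal n I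

namespace Coprod

/-- Each block of relations is contained in the coproduct ideal. [folklore] -/
theorem map_le_coprodIdeal (s : ι) : (I s).map (blockRename n s) ≤ coprodIdeal n I :=
  le_iSup (fun s => (I s).map (blockRename n s)) s

/-- The structure maps `X[x]/I s → ∐_s X[x]/I s`. [folklore] -/
noncomputable def of (s : ι) : Block n I s →ₐ[X] Coprod n I :=
  Ideal.quotientMapₐ (coprodIdeal n I) (blockRename n s)
    (Ideal.map_le_iff_le_comap.1 (map_le_coprodIdeal n I s))

/-- `Coprod.of` on representatives. [folklore] -/
theorem of_mk (s : ι) (p : MvPolynomial (Fin (n s)) X) :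
    of n I s (Ideal.Quotient.mk (I s) p) = Ideal.Quotient.mk (coprodIdeal n I) (blockRename n s p) :=
  rfl

variable {Q : Type u} [CommRing Q] [Algebra X Q]

/-- The polynomial-level map inducing `Coprod.lift`. [folklore] -/
noncomputable def liftPoly (φ : ∀ s, Block n I s →ₐ[X] Q) : MvPolynomial (Σ s, Fin (n s)) X →ₐ[X] Q :=
  MvPolynomial.aeval fun v => φ v.1 (Ideal.Quotient.mk (I v.1) (MvPolynomial.X v.2))

/-- `liftPoly` on the polynomials of a block. [folklore] -/
theorem liftPoly_blockRename (φ : ∀ s, Block n I s →ₐ[X] Q) (s : ι) (p : MvPolynomial (Fin (n s)) X) :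
    liftPoly n I φ (blockRename n s p) = φ s (Ideal.Quotient.mk (I s) p) := by
  rw [liftPoly, blockRename, MvPolynomial.aeval_rename]
  change MvPolynomial.aeval (fun i => ((φ s).comp (Ideal.Quotient.mkₐ X (I s))) (MvPolynomial.X i)) p = _
  rw [← MvPolynomial.comp_aeval, MvPolynomial.aeval_X_left]
  rfl

/-- `liftPoly` kills the coproduct ideal. [folklore] -/
theorem liftPoly_vanishes (φ : ∀ s, Block n I s →ₐ[X] Q) :
    ∀ p ∈ coprodIdeal n I, liftPoly n I φ p = 0 := by
  intro p hp
  rw [← RingHom.mem_ker]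
  revert hp p
  change coprodIdeal n I ≤ RingHom.ker (liftPoly n I φ)
  refine iSup_le fun s => Ideal.map_le_iff_le_comap.2 fun p hp => ?_
  rw [Ideal.mem_comap, RingHom.mem_ker, liftPoly_blockRename, Ideal.Quotient.eq_zero_iff_mem.2 hp, map_zero]

/-- **The universal map out of the coproduct** determined by a family of maps on the blocks.
[folklore] -/
noncomputable def lift (φ : ∀ s, Block n I s →ₐ[X] Q) : Coprod n I →ₐ[X] Q :=
  Ideal.Quotient.liftₐ (coprodIdeal n I) (liftPoly n I φ) (liftPoly_vanishes n I φ)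

/-- `Coprod.lift` on representatives. [folklore] -/
theorem lift_mk (φ : ∀ s, Block n I s →ₐ[X] Q) (p : MvPolynomial (Σ s, Fin (n s)) X) :
    lift n I φ (Ideal.Quotient.mk (coprodIdeal n I) p) = liftPoly n I φ p := rfl

/-- The universal map restricts to the given maps on the blocks. [folklore] -/
theorem lift_comp_of (φ : ∀ s, Block n I s →ₐ[X] Q) (s : ι) : (lift n I φ).comp (of n I s) = φ s := by
  refine Ideal.Quotient.algHom_ext _ (MvPolynomial.algHom_ext fun i => ?_)
  change lift n I φ (of n I s (Ideal.Quotient.mk (I s) (MvPolynomial.X i))) =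
    φ s (Ideal.Quotient.mk (I s) (MvPolynomial.X i))
  rw [of_mk, lift_mk, liftPoly_blockRename]

/-- `Coprod.lift` on a block (elementwise). [folklore] -/
theorem lift_of (φ : ∀ s, Block n I s →ₐ[X] Q) (s : ι) (b : Block n I s) :
    lift n I φ (of n I s b) = φ s b :=
  congrArg (fun ψ : Block n I s →ₐ[X] Q => ψ b) (lift_comp_of n I φ s)

/-- **Uniqueness**: two maps out of the coproduct agreeing on all blocks are equal. [folklore] -/
theorem hom_ext {f g : Coprod n I →ₐ[X] Q} (h : ∀ s, f.comp (of n I s) = g.comp (of n I s)) :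
    f = g := by
  refine Ideal.Quotient.algHom_ext _ (MvPolynomial.algHom_ext fun v => ?_)
  obtain ⟨s, i⟩ := v
  have := congrArg (fun ψ : Block n I s →ₐ[X] Q => ψ (Ideal.Quotient.mk (I s) (MvPolynomial.X i)))
    (h s)
  simpa only [AlgHom.comp_apply, of_mk, blockRename, MvPolynomial.rename_X,
    Ideal.Quotient.mkₐ_eq_mk] using this

/-- **The universal property of the coproduct**: maps out of `∐_s X[x]/I s` are families of maps
out of the blocks. [folklore] -/
noncomputable def homEquiv : (Coprod n I →ₐ[X] Q) ≃ (∀ s, Block n I s →ₐ[X] Q) where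
  toFun f := fun s => f.comp (of n I s)
  invFun φ := lift n I φ
  left_inv _ := hom_ext n I fun s => lift_comp_of n I _ s
  right_inv φ := funext fun s => lift_comp_of n I φ s

end Coprod


/-! ### Finite coproducts of étale algebras are étale -/

namespace Coprod

/-- The ideal of a finite coproduct of finitely presented blocks is finitely generated. [folklore] -/
theorem coprodIdeal_fg [Finite ι] [∀ s, Algebra.FinitePresentation X (Block n I s)] :
    (coprodIdeal n I).FG := by
  refine Submodule.fg_iSup _ fun s => Ideal.FG.map ?_ _
  have h := Algebra.FinitePresentation.ker_fG_of_surjective (Ideal.Quotient.mkₐ X (I s))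
    (Ideal.Quotient.mkₐ_surjective X (I s))
  have hk : RingHom.ker (Ideal.Quotient.mkₐ X (I s)).toRingHom = I s := Ideal.mk_ker
  rwa [hk] at h

/-- A finite coproduct of finitely presented algebras is finitely presented. [folklore] -/
theorem finitePresentation [Finite ι] [∀ s, Algebra.FinitePresentation X (Block n I s)] :
    Algebra.FinitePresentation X (Coprod n I) :=
  Algebra.FinitePresentation.quotient (coprodIdeal_fg n I)

/-- **A coproduct of formally étale algebras is formally étale**: infinitesimal lifting problems
for the coproduct are families of lifting problems for the blocks, each uniquely solvable.
[cite: StacksProject, Tag 00U0] -/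
theorem formallyEtale [∀ s, Algebra.FormallyEtale X (Block n I s)] :
    Algebra.FormallyEtale X (Coprod n I) := by
  rw [Algebra.FormallyEtale.iff_comp_bijective]
  intro B _ _ J hJ
  constructor
  · intro f g hfg
    refine hom_ext n I fun s => ?_
    apply (Algebra.FormallyEtale.comp_bijective X (Block n I s) J hJ).1
    change (Ideal.Quotient.mkₐ X J).comp (f.comp (of n I s)) =
      (Ideal.Quotient.mkₐ X J).comp (g.comp (of n I s))
    rw [← AlgHom.comp_assoc, ← AlgHom.comp_assoc]
    exact congrArg (fun ψ : Coprod n I →ₐ[X] B ⧸ J => ψ.comp (of n I s)) hfg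
  · intro g
    choose φ hφ using fun s =>
      (Algebra.FormallyEtale.comp_bijective X (Block n I s) J hJ).2 (g.comp (of n I s))
    refine ⟨lift n I φ, hom_ext n I fun s => ?_⟩
    change ((Ideal.Quotient.mkₐ X J).comp (lift n I φ)).comp (of n I s) = g.comp (of n I s)
    rw [AlgHom.comp_assoc, lift_comp_of]
    exact hφ s

/-- **A finite coproduct (tensor product) of étale algebras is étale.**
[cite: StacksProject, Tag 00U0] -/
theorem etale [Finite ι] [∀ s, Algebra.Etale X (Block n I s)] : Algebra.Etale X (Coprod n I) :=
  { formallyEtale := formallyEtale n I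
    finitePresentation := finitePresentation n I }

/-! ### Arbitrary coproducts of étale algebras are ind-étale -/

section SubCoprod

variable (E : Finset ι)

/-- The sub-coproduct over a finite set of blocks. [folklore] -/
abbrev Sub : Type u := Coprod (fun s : ↥E => n s.1) (fun s : ↥E => I s.1)

/-- `∐_{s ∈ E} → ∐_s`. [folklore] -/
noncomputable def subToCoprod : Sub n I E →ₐ[X] Coprod n I :=
  lift _ _ fun s : ↥E => of n I s.1

/-- The embedding of the variables of the blocks in `E`. [folklore] -/
def subEmb (v : Σ s : ↥E, Fin (n s.1)) : Σ s, Fin (n s) := ⟨v.1.1, v.2⟩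

omit [CommRing X] in
/-- `subEmb` is injective. [folklore] -/
theorem subEmb_injective : Function.Injective (subEmb n E) := by
  rintro ⟨⟨s, hs⟩, i⟩ ⟨⟨t, ht⟩, j⟩ h
  simp only [subEmb, Sigma.mk.inj_iff] at h
  obtain ⟨rfl, h⟩ := h
  simp [eq_of_heq h]

/-- `subToCoprod` on representatives is renaming of variables. [folklore] -/
theorem subToCoprod_mk (p : MvPolynomial (Σ s : ↥E, Fin (n s.1)) X) :
    subToCoprod n I E (Ideal.Quotient.mk _ p) =
      Ideal.Quotient.mk (coprodIdeal n I) (MvPolynomial.rename (subEmb n E) p) := by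
  change liftPoly _ _ (fun s : ↥E => of n I s.1) p = _
  have : (liftPoly (fun s : ↥E => n s.1) (fun s : ↥E => I s.1) fun s : ↥E => of n I s.1) =
      (Ideal.Quotient.mkₐ X (coprodIdeal n I)).comp (MvPolynomial.rename (subEmb n E)) := by
    refine MvPolynomial.algHom_ext fun v => ?_
    simp only [liftPoly, MvPolynomial.aeval_X, AlgHom.comp_apply, MvPolynomial.rename_X,
      Ideal.Quotient.mkₐ_eq_mk, of_mk, blockRename]
    rfl
  rw [this]
  rfl

/-- Killing the variables of the blocks outside `E`. [folklore] -/
noncomputable def killOutside :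
    MvPolynomial (Σ s, Fin (n s)) X →ₐ[X] MvPolynomial (Σ s : ↥E, Fin (n s.1)) X :=
  haveI := Classical.decEq ι
  MvPolynomial.aeval fun v => if h : v.1 ∈ E then MvPolynomial.X ⟨⟨v.1, h⟩, v.2⟩ else 0

/-- Killing the outside variables is a retraction of the renaming. [folklore] -/
theorem killOutside_rename_subEmb (p : MvPolynomial (Σ s : ↥E, Fin (n s.1)) X) :
    killOutside n E (MvPolynomial.rename (subEmb n E) p) = p := by
  classical
  have hcomp : (killOutside n E).comp (MvPolynomial.rename (subEmb n E)) = AlgHom.id X _ := by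
    refine MvPolynomial.algHom_ext fun v => ?_
    obtain ⟨⟨s, hs⟩, i⟩ := v
    simp [killOutside, subEmb, hs]
  exact congrArg (fun ψ : MvPolynomial (Σ s : ↥E, Fin (n s.1)) X →ₐ[X] _ => ψ p) hcomp

/-- Killing the outside variables fixes the blocks inside. [folklore] -/
theorem killOutside_comp_blockRename {s : ι} (hs : s ∈ E) :
    (killOutside n E).comp (blockRename n s) = blockRename (X := X) (fun s : ↥E => n s.1) ⟨s, hs⟩ := by
  classical
  refine MvPolynomial.algHom_ext fun i => ?_
  simp [killOutside, blockRename, hs]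

/-- Killing the outside variables sends a relation of a block in `E` into the ideal of the
sub-coproduct. [folklore] -/
theorem killOutside_blockRename_mem {s : ι} (hs : s ∈ E) (p : MvPolynomial (Fin (n s)) X)
    (hp : p ∈ I s) :
    killOutside n E (blockRename n s p) ∈ coprodIdeal (fun s : ↥E => n s.1) (fun s : ↥E => I s.1) := by
  have h := DFunLike.congr_fun (killOutside_comp_blockRename n E hs) p
  rw [AlgHom.comp_apply] at h
  rw [h]
  exact map_le_coprodIdeal (fun s : ↥E => n s.1) (fun s : ↥E => I s.1) ⟨s, hs⟩
    (Ideal.mem_map_of_mem (blockRename (X := X) (fun s : ↥E => n s.1) ⟨s, hs⟩) hp)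

/-- Killing the outside variables maps the relations of the blocks in `E` into the ideal of the
sub-coproduct. [folklore] -/
theorem killOutside_map_le :
    (⨆ s ∈ E, (I s).map (blockRename n s)).map (killOutside n E) ≤
      coprodIdeal (fun s : ↥E => n s.1) (fun s : ↥E => I s.1) := by
  rw [Ideal.map_iSup]
  refine iSup_le fun s => ?_
  rw [Ideal.map_iSup]
  refine iSup_le fun hs => ?_
  refine Ideal.map_le_iff_le_comap.2 (Ideal.map_le_iff_le_comap.2 fun p hp => ?_)
  rw [Ideal.mem_comap, Ideal.mem_comap]
  exact killOutside_blockRename_mem n I E hs p hp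

end SubCoprod

/-- **An arbitrary coproduct of étale algebras satisfies the ind-étale factorization
criterion**: a map from a finitely presented algebra involves finitely many blocks `E` (for the
generators and for the witnesses of the relations) and factors through the étale finite
sub-coproduct `∐_{s ∈ E}`. [cite: StacksProject, Tag 097R] -/
theorem factorsEtale [∀ s, Algebra.Etale X (Block n I s)] : FactorsEtale X (Coprod n I) := by
  classical
  intro P _ _ _ φ
  obtain ⟨m, π, hπ, hker⟩ := Algebra.FinitePresentation.out (R := X) (A := P)
  obtain ⟨S, hS⟩ := hker
  -- lift the generators to polynomials
  choose q hq using fun k : Fin m => Ideal.Quotient.mk_surjective (φ (π (MvPolynomial.X k)))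
  let ψ : MvPolynomial (Fin m) X →ₐ[X] MvPolynomial (Σ s, Fin (n s)) X := MvPolynomial.aeval q
  have hψ : (Ideal.Quotient.mkₐ X (coprodIdeal n I)).comp ψ = φ.comp π := by
    refine MvPolynomial.algHom_ext fun k => ?_
    simp [ψ, hq k]
  -- the relations lie in finitely many blocks
  have hrel : ∀ r ∈ S, ∃ F : Finset ι, ψ r ∈ ⨆ s ∈ F, (I s).map (blockRename n s) := by
    intro r hr
    have h0 : ψ r ∈ coprodIdeal n I := by
      rw [← Ideal.Quotient.eq_zero_iff_mem, ← Ideal.Quotient.mkₐ_eq_mk X, ← AlgHom.comp_apply, hψ,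
        AlgHom.comp_apply]
      have : r ∈ RingHom.ker π.toRingHom := hS ▸ Ideal.subset_span hr
      rw [RingHom.mem_ker] at this
      change φ (π r) = 0
      have h1 : π r = 0 := this
      rw [h1, map_zero]
    exact Submodule.exists_finset_of_mem_iSup _ h0
  choose! F hF using hrel
  -- the blocks involved
  let E : Finset ι := (Finset.univ.biUnion fun k => (q k).vars.image Sigma.fst) ∪ S.biUnion F
  -- the étale finite sub-coproduct
  haveI : ∀ s : ↥E, Algebra.Etale X (Block (fun s : ↥E => n s.1) (fun s : ↥E => I s.1) s) :=
    fun s => inferInstanceAs (Algebra.Etale X (Block n I s.1))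
  haveI : Algebra.Etale X (Sub n I E) := etale _ _
  -- the map `P → ∐_{s ∈ E}`
  let θ : MvPolynomial (Fin m) X →ₐ[X] Sub n I E :=
    (Ideal.Quotient.mkₐ X _).comp ((killOutside n E).comp ψ)
  have hθ : ∀ r, π r = 0 → θ r = 0 := by
    intro r hr
    have hr' : r ∈ Ideal.span (S : Set (MvPolynomial (Fin m) X)) := by
      rw [hS]; exact hr
    refine Submodule.span_induction (p := fun r _ => θ r = 0) ?_ (map_zero θ) ?_ ?_ hr'
    · intro r hr
      change Ideal.Quotient.mk _ (killOutside n E (ψ r)) = 0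
      refine Ideal.Quotient.eq_zero_iff_mem.2 (killOutside_map_le n I E (Ideal.mem_map_of_mem _ ?_))
      have hmono : (⨆ s ∈ F r, (I s).map (blockRename n s)) ≤ ⨆ s ∈ E, (I s).map (blockRename n s) :=
        biSup_mono fun s hs => Finset.mem_union_right _ (Finset.mem_biUnion.2 ⟨r, hr, hs⟩)
      exact hmono (hF r hr)
    · intro x y _ _ hx hy
      rw [map_add, hx, hy, add_zero]
    · intro a x _ hx
      rw [smul_eq_mul, map_mul, hx, mul_zero]
  refine ⟨Sub n I E, inferInstance, inferInstance, inferInstance, algHomOfSurjective π hπ θ hθ,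
    subToCoprod n I E, ?_⟩
  -- the factorization
  have key : ((subToCoprod n I E).comp (algHomOfSurjective π hπ θ hθ)).comp π = φ.comp π := by
    rw [AlgHom.comp_assoc, algHomOfSurjective_comp, ← hψ]
    refine MvPolynomial.algHom_ext fun k => ?_
    change subToCoprod n I E (Ideal.Quotient.mk _ (killOutside n E (ψ (MvPolynomial.X k)))) =
      Ideal.Quotient.mk _ (ψ (MvPolynomial.X k))
    have hqk : ψ (MvPolynomial.X k) = q k := MvPolynomial.aeval_X q k
    -- all variables of `q k` are in blocks of `E`
    obtain ⟨q', hq'⟩ := MvPolynomial.exists_rename_eq_of_vars_subset_range (q k) (subEmb n E)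
      (subEmb_injective n E) (by
        intro v hv
        have hvE : v.1 ∈ E := Finset.mem_union_left _
          (Finset.mem_biUnion.2 ⟨k, Finset.mem_univ k, Finset.mem_image_of_mem _ hv⟩)
        exact ⟨⟨⟨v.1, hvE⟩, v.2⟩, rfl⟩)
    rw [hqk, ← hq', killOutside_rename_subEmb, subToCoprod_mk]
  refine AlgHom.ext fun p => ?_
  obtain ⟨r, rfl⟩ := hπ p
  exact congrArg (fun χ : MvPolynomial (Fin m) X →ₐ[X] Coprod n I => χ r) key

end Coprod


/-! ### Flatness of ind-étale algebras -/

/-- **An algebra satisfying the ind-étale factorization criterion is flat** (a directed colimit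
of étale, hence flat, algebras). [cite: StacksProject, Tag 097N] -/
theorem FactorsEtale.flat {A C : Type u} [CommRing A] [CommRing C] [Algebra A C]
    (h : FactorsEtale A C) : Module.Flat A C := by
  obtain ⟨ι, _, _, _, G, _, _, _, f, _, ⟨e⟩⟩ := h.exists_directLimit_equiv
  haveI : Module.Flat A (DirectLimit G f) := flat_directLimit f
  exact Module.Flat.of_linearEquiv e.symm.toLinearEquiv

/-! ### Faithful flatness of coproducts of faithfully flat étale algebras -/

namespace Coprod

open TensorProduct

/-- A geometric point of a faithfully flat étale `X`-algebra over a prime `𝔭`: an `X`-algebra map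
to the algebraic closure of `κ(𝔭)` (the fibre `κ(𝔭) ⊗ B` is a nonzero finite `κ(𝔭)`-algebra; a
residue field of it is a finite extension of `κ(𝔭)`). [folklore] -/
theorem nonempty_algHom_algebraicClosure (B : Type u) [CommRing B] [Algebra X B] [Algebra.Etale X B]
    [Module.FaithfullyFlat X B] (𝔭 : Ideal X) [𝔭.IsPrime] :
    Nonempty (B →ₐ[X] AlgebraicClosure 𝔭.ResidueField) := by
  haveI : Nontrivial (𝔭.ResidueField ⊗[X] B) :=
    Module.FaithfullyFlat.rTensor_nontrivial X B 𝔭.ResidueField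
  haveI : Module.Finite 𝔭.ResidueField (𝔭.ResidueField ⊗[X] B) :=
    Algebra.FormallyUnramified.finite_of_free 𝔭.ResidueField (𝔭.ResidueField ⊗[X] B)
  obtain ⟨q, hq⟩ := Ideal.exists_maximal (𝔭.ResidueField ⊗[X] B)
  letI : Field ((𝔭.ResidueField ⊗[X] B) ⧸ q) := Ideal.Quotient.field q
  haveI : Module.Finite 𝔭.ResidueField ((𝔭.ResidueField ⊗[X] B) ⧸ q) :=
    Module.Finite.of_surjective (Ideal.Quotient.mkₐ 𝔭.ResidueField q).toLinearMap
      (Ideal.Quotient.mkₐ_surjective 𝔭.ResidueField q)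
  let g : ((𝔭.ResidueField ⊗[X] B) ⧸ q) →ₐ[𝔭.ResidueField] AlgebraicClosure 𝔭.ResidueField :=
    IsAlgClosed.lift
  exact ⟨(g.restrictScalars X).comp (((Ideal.Quotient.mkₐ 𝔭.ResidueField q).restrictScalars X).comp
    Algebra.TensorProduct.includeRight)⟩

/-- **Every prime of `X` lies under a prime of a coproduct of faithfully flat étale algebras**:
the kernel of `∐_s B_s → κ(𝔭)^alg` assembled from geometric points of the blocks.
[cite: StacksProject, Tag 097R] -/
theorem exists_prime_over [∀ s, Algebra.Etale X (Block n I s)] [∀ s, Module.FaithfullyFlat X (Block n I s)]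
    (𝔭 : Ideal X) [𝔭.IsPrime] :
    ∃ P : Ideal (Coprod n I), P.IsPrime ∧ P.comap (algebraMap X (Coprod n I)) = 𝔭 := by
  let φ : Coprod n I →ₐ[X] AlgebraicClosure 𝔭.ResidueField :=
    lift n I fun s => (nonempty_algHom_algebraicClosure (Block n I s) 𝔭).some
  refine ⟨RingHom.ker φ, RingHom.ker_isPrime _, ?_⟩
  ext x
  rw [Ideal.mem_comap, RingHom.mem_ker, AlgHom.commutes,
    IsScalarTower.algebraMap_apply X 𝔭.ResidueField (AlgebraicClosure 𝔭.ResidueField),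
    map_eq_zero_iff _ (algebraMap 𝔭.ResidueField (AlgebraicClosure 𝔭.ResidueField)).injective,
    Ideal.algebraMap_residueField_eq_zero]

/-- **A coproduct of faithfully flat étale algebras is faithfully flat** (flat as an ind-étale
algebra, and surjective on spectra). [cite: StacksProject, Tag 097R] -/
theorem faithfullyFlat [∀ s, Algebra.Etale X (Block n I s)] [∀ s, Module.FaithfullyFlat X (Block n I s)] :
    Module.FaithfullyFlat X (Coprod n I) := by
  haveI : Module.Flat X (Coprod n I) := (factorsEtale n I).flat
  refine Module.FaithfullyFlat.of_comap_surjective fun 𝔭 => ?_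
  obtain ⟨P, hP, hP𝔭⟩ := exists_prime_over n I 𝔭.asIdeal
  exact ⟨⟨P, hP⟩, PrimeSpectrum.ext hP𝔭⟩

end Coprod

end Literature.RingTheory.Etale
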